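import Summits.BirchSwinnertonDyer.BirchSwinnertonDyer.Theorems.Rank2ObservatoryRank2Table
import Summits.BirchSwinnertonDyer.BirchSwinnertonDyer.Theorems.Rank2ObservatoryRank2Rows50a
import Summits.BirchSwinnertonDyer.BirchSwinnertonDyer.Theorems.Rank2ObservatoryRank2Rows50b
import Summits.BirchSwinnertonDyer.BirchSwinnertonDyer.Theorems.Rank2ObservatoryRank2Rows51a
import Summits.BirchSwinnertonDyer.BirchSwinnertonDyer.Theorems.Rank2ObservatoryRank2Rows51b
import Summits.BirchSwinnertonDyer.BirchSwinnertonDyer.Theorems.Rank2ObservatoryRank2Rows52a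
import Summits.BirchSwinnertonDyer.BirchSwinnertonDyer.Theorems.Rank2ObservatoryRank2Rows52b
import Summits.BirchSwinnertonDyer.BirchSwinnertonDyer.Theorems.Rank2ObservatoryRank2Rows53a
import Summits.BirchSwinnertonDyer.BirchSwinnertonDyer.Theorems.Rank2ObservatoryRank2Rows53b
import Summits.BirchSwinnertonDyer.BirchSwinnertonDyer.Theorems.Rank2ObservatoryRank2Rows54a
import Summits.BirchSwinnertonDyer.BirchSwinnertonDyer.Theorems.Rank2ObservatoryRank2Rows54b
import Summits.BirchSwinnertonDyer.BirchSwinnertonDyer.Theorems.Rank2ObservatoryRank2Rows55a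
import Summits.BirchSwinnertonDyer.BirchSwinnertonDyer.Theorems.Rank2ObservatoryRank2Rows55b
import Summits.BirchSwinnertonDyer.BirchSwinnertonDyer.Theorems.Rank2ObservatoryRank2Rows56a
import Summits.BirchSwinnertonDyer.BirchSwinnertonDyer.Theorems.Rank2ObservatoryRank2Rows56b
import Summits.BirchSwinnertonDyer.BirchSwinnertonDyer.Theorems.Rank2ObservatoryRank2Rows57a
import Summits.BirchSwinnertonDyer.BirchSwinnertonDyer.Theorems.Rank2ObservatoryRank2Rows57b
import Summits.BirchSwinnertonDyer.BirchSwinnertonDyer.Theorems.Rank2ObservatoryRank2Rows58a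
import Summits.BirchSwinnertonDyer.BirchSwinnertonDyer.Theorems.Rank2ObservatoryRank2Rows58b
import Summits.BirchSwinnertonDyer.BirchSwinnertonDyer.Theorems.Rank2ObservatoryRank2Rows59a
import Summits.BirchSwinnertonDyer.BirchSwinnertonDyer.Theorems.Rank2ObservatoryRank2Rows59b
import HarnessLib

/-!
# BirchSwinnertonDyer — rank ≥ 2 observatory: rank-2 census table, decade 5 of 10 (`250000 ≤ N < 300000`)

HONEST FRAMING: per-curve certified theorems and census instruments; no claim on BSD in rank ≥ 2.

Machine-written AGGREGATION level of the rank-2 census (schema `Rank2ObservatoryRank2Table.lean`, data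
chunks `Rank2ObservatoryRank2Rows50a … 59b`, census `Rank2ObservatoryRank2Census.lean`): `rank2Decade5` is the
concatenation of the 20 chunks of conductor windows 50–59 (`250000 ≤ N < 300000`; a window above the gate's
200 kB file cap is stored as two half-window chunks `NNa`, `NNb`) — rows 162956–199830 of `rank2_table.tsv`
(sha256 `8b151c933b69ee8dae4834c21efd171353ae94c887716c05b7381d12d173f912`), 36875 curves from `250001g1` to
`299998a1`. Its theorems are assembled from the chunk theorems (each a kernel `decide`) by
`List.all_append` / `List.length_append` rewriting only; no row is re-evaluated here. The two-level
assembly (chunks → decades → table) keeps every file under the tree's 400-line limit and every list short.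

Reference: J. E. Cremona, *Algorithms for Modular Elliptic Curves* (2nd ed. 1997), tables / ecdata.
-/

-- single-conjunct summit: `Summit.BirchSwinnertonDyer.BirchSwinnertonDyer.…` repeats the name by design
set_option linter.dupNamespace false

namespace Summit.BirchSwinnertonDyer.BirchSwinnertonDyer.Rank2Observatory

/-- The 20 chunks of decade 5 (conductors `250000 ≤ N < 300000`), in order. [cite: CremonaAlgorithms1997, Tables] -/
noncomputable def rank2Decade5Chunks : List (List Rank2Row) := [
  rank2Rows50a, rank2Rows50b, rank2Rows51a, rank2Rows51b, rank2Rows52a, rank2Rows52b,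
  rank2Rows53a, rank2Rows53b, rank2Rows54a, rank2Rows54b, rank2Rows55a, rank2Rows55b,
  rank2Rows56a, rank2Rows56b, rank2Rows57a, rank2Rows57b, rank2Rows58a, rank2Rows58b,
  rank2Rows59a, rank2Rows59b]

/-- Decade 5 of the rank-2 census table: the 36875 rank-2 curves of conductor `250000 ≤ N < 300000` (rows 162956–199830).
[cite: CremonaAlgorithms1997, Tables] -/
noncomputable def rank2Decade5 : List Rank2Row :=
  rank2Decade5Chunks.flatten

/-- Every row of decade 5 satisfies `Rank2Row.check` (from the 20 chunk theorems). [folklore] -/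
theorem rank2Decade5_check : rank2Decade5.all Rank2Row.check = true := by
  simp only [rank2Decade5, rank2Decade5Chunks, List.flatten_cons, List.flatten_nil, List.all_append, List.all_nil,
    Bool.and_true,
    rank2Rows50a_check, rank2Rows50b_check, rank2Rows51a_check, rank2Rows51b_check,
    rank2Rows52a_check, rank2Rows52b_check, rank2Rows53a_check, rank2Rows53b_check,
    rank2Rows54a_check, rank2Rows54b_check, rank2Rows55a_check, rank2Rows55b_check,
    rank2Rows56a_check, rank2Rows56b_check, rank2Rows57a_check, rank2Rows57b_check,
    rank2Rows58a_check, rank2Rows58b_check, rank2Rows59a_check, rank2Rows59b_check]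

/-- Decade 5 has `36875` rows (sum of the 20 kernel-counted chunk lengths). [cite: CremonaAlgorithms1997, Tables] -/
theorem rank2Decade5_length : rank2Decade5.length = 36875 := by
  simp only [rank2Decade5, rank2Decade5Chunks, List.flatten_cons, List.flatten_nil, List.length_append, List.length_nil,
    rank2Rows50a_length, rank2Rows50b_length, rank2Rows51a_length, rank2Rows51b_length,
    rank2Rows52a_length, rank2Rows52b_length, rank2Rows53a_length, rank2Rows53b_length,
    rank2Rows54a_length, rank2Rows54b_length, rank2Rows55a_length, rank2Rows55b_length,
    rank2Rows56a_length, rank2Rows56b_length, rank2Rows57a_length, rank2Rows57b_length,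
    rank2Rows58a_length, rank2Rows58b_length, rank2Rows59a_length, rank2Rows59b_length]

/-- Every conductor of decade 5 is `< 500 000` (from the 20 kernel-checked chunk ranges).
[cite: CremonaAlgorithms1997, Tables] -/
theorem rank2Decade5_conductor_lt : rank2Decade5.all (fun r => decide (r.N < 500000)) = true := by
  simp only [rank2Decade5, rank2Decade5Chunks, List.flatten_cons, List.flatten_nil, List.all_append, List.all_nil,
    Bool.and_true,
    Rank2Row.all_conductorLt_of_all_range (by norm_num) rank2Rows50a_conductor,
    Rank2Row.all_conductorLt_of_all_range (by norm_num) rank2Rows50b_conductor,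
    Rank2Row.all_conductorLt_of_all_range (by norm_num) rank2Rows51a_conductor,
    Rank2Row.all_conductorLt_of_all_range (by norm_num) rank2Rows51b_conductor,
    Rank2Row.all_conductorLt_of_all_range (by norm_num) rank2Rows52a_conductor,
    Rank2Row.all_conductorLt_of_all_range (by norm_num) rank2Rows52b_conductor,
    Rank2Row.all_conductorLt_of_all_range (by norm_num) rank2Rows53a_conductor,
    Rank2Row.all_conductorLt_of_all_range (by norm_num) rank2Rows53b_conductor,
    Rank2Row.all_conductorLt_of_all_range (by norm_num) rank2Rows54a_conductor,
    Rank2Row.all_conductorLt_of_all_range (by norm_num) rank2Rows54b_conductor,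
    Rank2Row.all_conductorLt_of_all_range (by norm_num) rank2Rows55a_conductor,
    Rank2Row.all_conductorLt_of_all_range (by norm_num) rank2Rows55b_conductor,
    Rank2Row.all_conductorLt_of_all_range (by norm_num) rank2Rows56a_conductor,
    Rank2Row.all_conductorLt_of_all_range (by norm_num) rank2Rows56b_conductor,
    Rank2Row.all_conductorLt_of_all_range (by norm_num) rank2Rows57a_conductor,
    Rank2Row.all_conductorLt_of_all_range (by norm_num) rank2Rows57b_conductor,
    Rank2Row.all_conductorLt_of_all_range (by norm_num) rank2Rows58a_conductor,
    Rank2Row.all_conductorLt_of_all_range (by norm_num) rank2Rows58b_conductor,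
    Rank2Row.all_conductorLt_of_all_range (by norm_num) rank2Rows59a_conductor,
    Rank2Row.all_conductorLt_of_all_range (by norm_num) rank2Rows59b_conductor]

/-- A row of a chunk of decade 5 is a row of the decade. [folklore] -/
theorem mem_rank2Decade5_of_mem_chunk {l : List Rank2Row} (hl : l ∈ rank2Decade5Chunks) {r : Rank2Row} (hr : r ∈ l) :
    r ∈ rank2Decade5 :=
  List.mem_flatten.mpr ⟨l, hl, hr⟩

/-- Chunk 50a is a chunk of decade 5. [folklore] -/
theorem rank2Rows50a_mem_decade5 : rank2Rows50a ∈ rank2Decade5Chunks :=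
  List.mem_iff_getElem?.mpr ⟨0, rfl⟩

/-- Chunk 50b is a chunk of decade 5. [folklore] -/
theorem rank2Rows50b_mem_decade5 : rank2Rows50b ∈ rank2Decade5Chunks :=
  List.mem_iff_getElem?.mpr ⟨1, rfl⟩

/-- Chunk 51a is a chunk of decade 5. [folklore] -/
theorem rank2Rows51a_mem_decade5 : rank2Rows51a ∈ rank2Decade5Chunks :=
  List.mem_iff_getElem?.mpr ⟨2, rfl⟩

/-- Chunk 51b is a chunk of decade 5. [folklore] -/
theorem rank2Rows51b_mem_decade5 : rank2Rows51b ∈ rank2Decade5Chunks :=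
  List.mem_iff_getElem?.mpr ⟨3, rfl⟩

/-- Chunk 52a is a chunk of decade 5. [folklore] -/
theorem rank2Rows52a_mem_decade5 : rank2Rows52a ∈ rank2Decade5Chunks :=
  List.mem_iff_getElem?.mpr ⟨4, rfl⟩

/-- Chunk 52b is a chunk of decade 5. [folklore] -/
theorem rank2Rows52b_mem_decade5 : rank2Rows52b ∈ rank2Decade5Chunks :=
  List.mem_iff_getElem?.mpr ⟨5, rfl⟩

/-- Chunk 53a is a chunk of decade 5. [folklore] -/
theorem rank2Rows53a_mem_decade5 : rank2Rows53a ∈ rank2Decade5Chunks :=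
  List.mem_iff_getElem?.mpr ⟨6, rfl⟩

/-- Chunk 53b is a chunk of decade 5. [folklore] -/
theorem rank2Rows53b_mem_decade5 : rank2Rows53b ∈ rank2Decade5Chunks :=
  List.mem_iff_getElem?.mpr ⟨7, rfl⟩

/-- Chunk 54a is a chunk of decade 5. [folklore] -/
theorem rank2Rows54a_mem_decade5 : rank2Rows54a ∈ rank2Decade5Chunks :=
  List.mem_iff_getElem?.mpr ⟨8, rfl⟩

/-- Chunk 54b is a chunk of decade 5. [folklore] -/
theorem rank2Rows54b_mem_decade5 : rank2Rows54b ∈ rank2Decade5Chunks :=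
  List.mem_iff_getElem?.mpr ⟨9, rfl⟩

/-- Chunk 55a is a chunk of decade 5. [folklore] -/
theorem rank2Rows55a_mem_decade5 : rank2Rows55a ∈ rank2Decade5Chunks :=
  List.mem_iff_getElem?.mpr ⟨10, rfl⟩

/-- Chunk 55b is a chunk of decade 5. [folklore] -/
theorem rank2Rows55b_mem_decade5 : rank2Rows55b ∈ rank2Decade5Chunks :=
  List.mem_iff_getElem?.mpr ⟨11, rfl⟩

/-- Chunk 56a is a chunk of decade 5. [folklore] -/
theorem rank2Rows56a_mem_decade5 : rank2Rows56a ∈ rank2Decade5Chunks :=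
  List.mem_iff_getElem?.mpr ⟨12, rfl⟩

/-- Chunk 56b is a chunk of decade 5. [folklore] -/
theorem rank2Rows56b_mem_decade5 : rank2Rows56b ∈ rank2Decade5Chunks :=
  List.mem_iff_getElem?.mpr ⟨13, rfl⟩

/-- Chunk 57a is a chunk of decade 5. [folklore] -/
theorem rank2Rows57a_mem_decade5 : rank2Rows57a ∈ rank2Decade5Chunks :=
  List.mem_iff_getElem?.mpr ⟨14, rfl⟩

/-- Chunk 57b is a chunk of decade 5. [folklore] -/
theorem rank2Rows57b_mem_decade5 : rank2Rows57b ∈ rank2Decade5Chunks :=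
  List.mem_iff_getElem?.mpr ⟨15, rfl⟩

/-- Chunk 58a is a chunk of decade 5. [folklore] -/
theorem rank2Rows58a_mem_decade5 : rank2Rows58a ∈ rank2Decade5Chunks :=
  List.mem_iff_getElem?.mpr ⟨16, rfl⟩

/-- Chunk 58b is a chunk of decade 5. [folklore] -/
theorem rank2Rows58b_mem_decade5 : rank2Rows58b ∈ rank2Decade5Chunks :=
  List.mem_iff_getElem?.mpr ⟨17, rfl⟩

/-- Chunk 59a is a chunk of decade 5. [folklore] -/
theorem rank2Rows59a_mem_decade5 : rank2Rows59a ∈ rank2Decade5Chunks :=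
  List.mem_iff_getElem?.mpr ⟨18, rfl⟩

/-- Chunk 59b is a chunk of decade 5. [folklore] -/
theorem rank2Rows59b_mem_decade5 : rank2Rows59b ∈ rank2Decade5Chunks :=
  List.mem_iff_getElem?.mpr ⟨19, rfl⟩

end Summit.BirchSwinnertonDyer.BirchSwinnertonDyer.Rank2Observatory
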